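import Mathlib

/-!
# Stub `stub_engine` for crux `SignCone.SignConeDuality` (stmt-RiemannHypothesis-16304), line Sketch

The abstract, topology-free ENGINE of the conic-duality step: Lagrange multipliers for finitely
many sign constraints on a set `S ⊆ ℝ × ℝ^ι` closed under `+` and positive scaling, with a
Slater point. One sign constraint at a time: the multiplier is an `sInf` of ratios; `N`
constraints by induction on `N`, peeling the last coordinate; an arbitrary finite index type via
`Fintype.equivFin`. No Hahn–Banach, no closure, no convexity hypothesis beyond closure under `+`
and positive scaling.
-/

noncomputable section

open scoped BigOperators
open Finset

namespace Summit.RiemannHypothesis.RiemannHypothesis.Theorems.SignConeDuality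

-- adapted from Cruxes/SignConeDuality/SketchIdeator1.lean (crux-ideate r1 k1)
/-- **One-constraint ratio lemma.** `S ⊆ ℝ × ℝ` closed under addition and positive scaling,
`0 ≤ x.2 → 0 ≤ x.1` on `S`, and a Slater point `x.2 > 0` in `S`. Then some `l ≥ 0` has
`l * x.2 ≤ x.1` on `S`. Proof: `l := sInf {x.1 / x.2 | x ∈ S, 0 < x.2}`; the only geometric input
is that for `x.2 < 0 < y.2` the positive combination `y.2 • x + (-x.2) • y ∈ S` has second
coordinate `0`, whence `x.1 / x.2 ≤ y.1 / y.2`. -/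
theorem one_multiplier (S : Set (ℝ × ℝ))
    (hadd : ∀ x ∈ S, ∀ y ∈ S, x + y ∈ S)
    (hsmul : ∀ r : ℝ, 0 < r → ∀ x ∈ S, r • x ∈ S)
    (hpos : ∀ x ∈ S, 0 ≤ x.2 → 0 ≤ x.1)
    (hslater : ∃ x ∈ S, 0 < x.2) :
    ∃ l : ℝ, 0 ≤ l ∧ ∀ x ∈ S, l * x.2 ≤ x.1 := by
  classical
  set A : Set ℝ := {r | ∃ x ∈ S, 0 < x.2 ∧ r = x.1 / x.2} with hA
  have hAne : A.Nonempty := by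
    obtain ⟨x, hx, hx2⟩ := hslater
    exact ⟨x.1 / x.2, x, hx, hx2, rfl⟩
  have hA0 : ∀ r ∈ A, 0 ≤ r := by
    rintro r ⟨x, hx, hx2, rfl⟩
    exact div_nonneg (hpos x hx hx2.le) hx2.le
  have hAbdd : BddBelow A := ⟨0, hA0⟩
  -- ratios at points with negative second coordinate lie below all of `A`
  have hkey : ∀ x ∈ S, x.2 < 0 → ∀ r ∈ A, x.1 / x.2 ≤ r := by
    rintro x hx hx2 r ⟨y, hy, hy2, rfl⟩
    have hz : y.2 • x + (-x.2) • y ∈ S :=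
      hadd _ (hsmul _ hy2 x hx) _ (hsmul _ (by linarith) y hy)
    have hz2 : (0 : ℝ) ≤ (y.2 • x + (-x.2) • y).2 := by
      simp only [Prod.snd_add, Prod.smul_snd, smul_eq_mul]
      nlinarith
    have hz1 : 0 ≤ (y.2 • x + (-x.2) • y).1 := hpos _ hz hz2
    simp only [Prod.fst_add, Prod.smul_fst, smul_eq_mul] at hz1
    rw [div_le_iff_of_neg hx2, div_mul_eq_mul_div, div_le_iff₀ hy2]
    nlinarith
  refine ⟨sInf A, le_csInf hAne hA0, fun x hx => ?_⟩
  rcases lt_trichotomy x.2 0 with h | h | h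
  · have h1 : x.1 / x.2 ≤ sInf A := le_csInf hAne (hkey x hx h)
    rwa [div_le_iff_of_neg h] at h1
  · rw [h, mul_zero]
    exact hpos x hx h.ge
  · have h1 : sInf A ≤ x.1 / x.2 := csInf_le hAbdd ⟨x, hx, h, rfl⟩
    rwa [le_div_iff₀ h] at h1

-- adapted from Cruxes/SignConeDuality/SketchIdeator1.lean (crux-ideate r1 k1)
/-- **Cone multipliers by ratio induction** (finitely many sign constraints, indexed by `Fin N`).
`S ⊆ ℝ × ℝ^N` closed under `+` and positive scaling; if `x.2 ≥ 0 ⇒ x.1 ≥ 0` on `S` and `S` has a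
Slater point (all `x.2 i > 0`), then `∃ l ≥ 0` with `∑ i, l i * x.2 i ≤ x.1` on `S`.
Induction on `N`: peel the last constraint with `one_multiplier` on the cone of points whose
first `N` constraint coordinates are nonnegative, then recurse on the reduced cone with first
coordinate `x.1 - l_N * x.2 (last)`. -/
theorem cone_multipliers_fin : ∀ (N : ℕ) (S : Set (ℝ × (Fin N → ℝ))),
    (∀ x ∈ S, ∀ y ∈ S, x + y ∈ S) →
    (∀ r : ℝ, 0 < r → ∀ x ∈ S, r • x ∈ S) →
    (∀ x ∈ S, (∀ i, 0 ≤ x.2 i) → 0 ≤ x.1) →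
    (∃ x ∈ S, ∀ i, 0 < x.2 i) →
    ∃ l : Fin N → ℝ, (∀ i, 0 ≤ l i) ∧ ∀ x ∈ S, ∑ i, l i * x.2 i ≤ x.1 := by
  intro N
  induction N with
  | zero =>
    intro S _ _ hpos _
    exact ⟨fun _ => 0, fun i => i.elim0, fun x hx => by simpa using hpos x hx fun i => i.elim0⟩
  | succ N ih =>
    intro S hadd hsmul hpos hsl
    -- Step 1: the last constraint, on the cone where the first `N` constraints hold.
    let T : Set (ℝ × ℝ) :=
      {p | ∃ x ∈ S, (∀ i : Fin N, 0 ≤ x.2 (Fin.castSucc i)) ∧ p = (x.1, x.2 (Fin.last N))}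
    have hTadd : ∀ p ∈ T, ∀ q ∈ T, p + q ∈ T := by
      rintro p ⟨x, hx, hxn, rfl⟩ q ⟨y, hy, hyn, rfl⟩
      refine ⟨x + y, hadd x hx y hy, fun i => ?_, ?_⟩
      · simp only [Prod.snd_add, Pi.add_apply]
        exact add_nonneg (hxn i) (hyn i)
      · simp
    have hTsmul : ∀ r : ℝ, 0 < r → ∀ p ∈ T, r • p ∈ T := by
      rintro r hr p ⟨x, hx, hxn, rfl⟩
      refine ⟨r • x, hsmul r hr x hx, fun i => ?_, ?_⟩
      · simp only [Prod.smul_snd, Pi.smul_apply, smul_eq_mul]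
        exact mul_nonneg hr.le (hxn i)
      · simp
    have hTpos : ∀ p ∈ T, 0 ≤ p.2 → 0 ≤ p.1 := by
      rintro p ⟨x, hx, hxn, rfl⟩ hp
      refine hpos x hx fun i => ?_
      refine Fin.lastCases ?_ (fun j => ?_) i
      · simpa using hp
      · exact hxn j
    have hTsl : ∃ p ∈ T, 0 < p.2 := by
      obtain ⟨x, hx, hxp⟩ := hsl
      exact ⟨(x.1, x.2 (Fin.last N)), ⟨x, hx, fun i => (hxp _).le, rfl⟩, hxp _⟩
    obtain ⟨lN, hlN0, hlN⟩ := one_multiplier T hTadd hTsmul hTpos hTsl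
    -- Step 2: the reduced cone in `ℝ × ℝ^N`.
    let S' : Set (ℝ × (Fin N → ℝ)) :=
      {q | ∃ x ∈ S, q = (x.1 - lN * x.2 (Fin.last N), fun i => x.2 (Fin.castSucc i))}
    have hS'add : ∀ p ∈ S', ∀ q ∈ S', p + q ∈ S' := by
      rintro p ⟨x, hx, rfl⟩ q ⟨y, hy, rfl⟩
      refine ⟨x + y, hadd x hx y hy, Prod.ext ?_ (funext fun i => ?_)⟩
      · simp only [Prod.fst_add, Prod.snd_add, Pi.add_apply]; ring
      · simp
    have hS'smul : ∀ r : ℝ, 0 < r → ∀ p ∈ S', r • p ∈ S' := by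
      rintro r hr p ⟨x, hx, rfl⟩
      refine ⟨r • x, hsmul r hr x hx, Prod.ext ?_ (funext fun i => ?_)⟩
      · simp only [Prod.smul_fst, Prod.smul_snd, Pi.smul_apply, smul_eq_mul]; ring
      · simp
    have hS'pos : ∀ q ∈ S', (∀ i, 0 ≤ q.2 i) → 0 ≤ q.1 := by
      rintro q ⟨x, hx, rfl⟩ hq
      have := hlN (x.1, x.2 (Fin.last N)) ⟨x, hx, hq, rfl⟩
      simp only at this ⊢
      linarith
    have hS'sl : ∃ q ∈ S', ∀ i, 0 < q.2 i := by
      obtain ⟨x, hx, hxp⟩ := hsl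
      exact ⟨_, ⟨x, hx, rfl⟩, fun i => hxp _⟩
    obtain ⟨l', hl'0, hl'⟩ := ih S' hS'add hS'smul hS'pos hS'sl
    refine ⟨Fin.snoc l' lN, fun i => ?_, fun x hx => ?_⟩
    · refine Fin.lastCases ?_ (fun j => ?_) i
      · simpa using hlN0
      · simpa using hl'0 j
    · have := hl' _ ⟨x, hx, rfl⟩
      simp only at this
      rw [Fin.sum_univ_castSucc]
      simp only [Fin.snoc_castSucc, Fin.snoc_last]
      linarith

-- adapted from Cruxes/SignConeDuality/SketchIdeator1.lean (crux-ideate r1 k1)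
/-- **Cone multipliers** for an arbitrary finite index type (e.g. the node set
`{n : ℕ // 2 ≤ n ∧ Real.log n < 2a}` or `Fin N` with node `i ↦ i + 2`): transport of
`cone_multipliers_fin` along `Fintype.equivFin ι`. -/
theorem cone_multipliers {ι : Type*} [Fintype ι] (S : Set (ℝ × (ι → ℝ)))
    (hadd : ∀ x ∈ S, ∀ y ∈ S, x + y ∈ S)
    (hsmul : ∀ r : ℝ, 0 < r → ∀ x ∈ S, r • x ∈ S)
    (hpos : ∀ x ∈ S, (∀ i, 0 ≤ x.2 i) → 0 ≤ x.1)
    (hslater : ∃ x ∈ S, ∀ i, 0 < x.2 i) :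
    ∃ l : ι → ℝ, (∀ i, 0 ≤ l i) ∧ ∀ x ∈ S, ∑ i, l i * x.2 i ≤ x.1 := by
  classical
  let e := Fintype.equivFin ι
  let S' : Set (ℝ × (Fin (Fintype.card ι) → ℝ)) := {q | ∃ x ∈ S, q = (x.1, fun j => x.2 (e.symm j))}
  have hadd' : ∀ p ∈ S', ∀ q ∈ S', p + q ∈ S' := by
    rintro p ⟨x, hx, rfl⟩ q ⟨y, hy, rfl⟩
    exact ⟨x + y, hadd x hx y hy, by ext <;> simp⟩
  have hsmul' : ∀ r : ℝ, 0 < r → ∀ p ∈ S', r • p ∈ S' := by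
    rintro r hr p ⟨x, hx, rfl⟩
    exact ⟨r • x, hsmul r hr x hx, by ext <;> simp⟩
  have hpos' : ∀ q ∈ S', (∀ j, 0 ≤ q.2 j) → 0 ≤ q.1 := by
    rintro q ⟨x, hx, rfl⟩ hq
    exact hpos x hx fun i => by simpa using hq (e i)
  have hsl' : ∃ q ∈ S', ∀ j, 0 < q.2 j := by
    obtain ⟨x, hx, hxp⟩ := hslater
    exact ⟨_, ⟨x, hx, rfl⟩, fun j => hxp _⟩
  obtain ⟨l', hl'0, hl'⟩ := cone_multipliers_fin _ S' hadd' hsmul' hpos' hsl'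
  refine ⟨fun i => l' (e i), fun i => hl'0 _, fun x hx => ?_⟩
  have h := hl' _ ⟨x, hx, rfl⟩
  simp only at h
  calc ∑ i, l' (e i) * x.2 i = ∑ j, l' j * x.2 (e.symm j) := by
        rw [← e.sum_comp]
        simp
    _ ≤ x.1 := h

/-- **Stub `stub_engine`** (registered signature, line Sketch of crux `SignCone.SignConeDuality`):
the topology-free conic-duality ENGINE. For a finite index type `ι` and a set
`S ⊆ ℝ × ℝ^ι` closed under `+` and positive scaling, if `x.2 ≥ 0 ⇒ x.1 ≥ 0` on `S` and `S`
has a Slater point (all `x.2 i > 0`), then there are multipliers `l ≥ 0` with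
`∑ i, l i * x.2 i ≤ x.1` on `S`. Immediate from `cone_multipliers`. -/
theorem stub_engine : ∀ (ι : Type) [Fintype ι] (S : Set (ℝ × (ι → ℝ))),
    (∀ x ∈ S, ∀ y ∈ S, x + y ∈ S) →
    (∀ r : ℝ, 0 < r → ∀ x ∈ S, r • x ∈ S) →
    (∀ x ∈ S, (∀ i, 0 ≤ x.2 i) → 0 ≤ x.1) →
    (∃ x ∈ S, ∀ i, 0 < x.2 i) →
    ∃ l : ι → ℝ, (∀ i, 0 ≤ l i) ∧ ∀ x ∈ S, ∑ i, l i * x.2 i ≤ x.1 := by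
  intro ι _ S hadd hsmul hpos hsl
  exact cone_multipliers S hadd hsmul hpos hsl

end Summit.RiemannHypothesis.RiemannHypothesis.Theorems.SignConeDuality

end
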